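import Literature.AlgebraicGeometry.Resolution.ResolutionOfSingularities
import HarnessLib

/-!
# ResolutionOfSingularities — problem statement (D-0013; operator-created)

Resolution of singularities in positive characteristic (EGA IV₂ 7.9.1/7.9.6 restricted to schemes
of finite type over a field; Hauser 2010, §A "nonembedded resolution"): for every prime `p`, every
field `k` of characteristic `p` and every reduced, separated `k`-scheme `X` of finite type there is a
proper birational morphism `π : X̃ → X` with `X̃` regular (every stalk a regular local ring).

The statement is the Literature definition `Literature.AlgebraicGeometry.Resolution.ResolutionOfSingularities`
(`Literature/AlgebraicGeometry/Resolution/ResolutionOfSingularities.lean`), imported not restated: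
`∀ p, p.Prime → ResolutionInChar.{0} p`, where `ResolutionInChar p` quantifies over
`(k : Type) [Field k] [CharP k p] (X : Scheme.{0}) (f : X ⟶ Spec k)` with
`IsSeparated f`, `LocallyOfFiniteType f`, `QuasiCompact f`, `IsReduced X`, and concludes
`Scheme.HasResolution X := ∃ X' (π : X' ⟶ X), IsProper π ∧ IsBirational π ∧ Scheme.IsRegular X'`
(`IsBirational π` = some dense open `U ⊆ X` has dense preimage and `π ∣_ U` is an isomorphism —
EGA I 6.5.5 / EGA IV₂ proof of 7.9.3; `IsRegular` = all stalks `IsRegularLocalRing`, Stacks 02IS).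

Weak (non-embedded) form: no isomorphism over `Reg X`, no projectivity of `π`, no normal-crossings
exceptional divisor. Characteristic `0` (Hironaka 1964) and dimension `≤ 3` (Cossart–Piltant 2019)
are theorems, vendored as the named facts `Hironaka1964`, `CossartPiltant2019` in the same file.
-/

/-- **ResolutionOfSingularities** (D-0013, tier 2): for every prime `p`, every field `k` of
characteristic `p` and every reduced separated `k`-scheme `X` of finite type, there is a proper
birational morphism `π : X̃ → X` with `X̃` regular (all stalks regular local rings) — the
"morphisme résolvant" of EGA IV₂ 7.9.1; open in every positive characteristic in dimension `≥ 4`.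
[cite: Kollar2007, Ch. 3 (the problem in char p); EGA IV₂ 7.9.1, Rem. 7.9.6] [problem: ResolutionOfSingularities] -/
def ResolutionOfSingularities : Prop := Literature.AlgebraicGeometry.Resolution.ResolutionOfSingularities

/-- Unfolding: the summit is resolution in every prime characteristic (universe `0`). [folklore] -/
theorem ResolutionOfSingularities_iff :
    ResolutionOfSingularities ↔ ∀ p : ℕ, p.Prime → Literature.AlgebraicGeometry.Resolution.ResolutionInChar.{0} p :=
  Iff.rfl
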